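import Literature.AlgebraicGeometry.Resolution.KollarSurfaceOrderReductionTame
import Literature.AlgebraicGeometry.Resolution.KollarEtaleNeighbourhood
import Literature.AlgebraicGeometry.Resolution.OrderSemicontinuity
import Literature.AlgebraicGeometry.Resolution.HypersurfaceCentres
import Literature.AlgebraicGeometry.Resolution.MonomialMarkedIdeals
import Literature.AlgebraicGeometry.Resolution.KollarMaxContactCharts
import HarnessLib

/-!
# Order reduction for marked ideals on surfaces in the tame regime `ord < p`: the local theorem at every closed point

Topic: `Literature/AlgebraicGeometry/Resolution`. Continuation of
`KollarSurfaceOrderReductionTame.lean` (J. Kollár, *Lectures on Resolution of Singularities*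
(2007), Thm. 3.69 via 3.104 Step 2.2 and 3.111 Step 1; BGMW arXiv:1206.3090, Def. 3.1.3,
Thm. 8.0.4): at a closed point `x` of a SURFACE (`dim 𝒪_{X,x} = 2`) the cosupport
`cosupp(I, b)` (closed, `= V(MC(I))` in the tame regime) either has `x` as an isolated point
(treated there: maximal-contact curve + characteristic-free order reduction in dimension one +
going up) or contains a proper generization `η ⤳ x`, i.e. a curve through `x`; in the latter
case Kollár's 3.111 Step 1 applies: near `x` the ideal IS the `b`-th power of the
maximal-contact hypersurface ideal, `I = H^b`, and the single (isomorphic) blowing up of the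
regular curve `V(H)` resolves `(I, b)`.

* `Kollar2007.exists_isResolutionOf_nhd_of_opens` — bookkeeping: a local resolution on an open
  `V ∋ x` is a local resolution on `X` (BGMW Thm. 8.0.5 (2) for open immersions);
* `Kollar2007.stalkIdeal_eq_span_pow_of_specializes` — **`I_x = (v^b) = H_x^b`** if a proper
  generization `η ⤳ x` lies in `cosupp(I, b) ∩ V(H)`, `H_x = (v)` with `v ∉ 𝔪_x²`,
  `dim 𝒪_{X,x} ≤ 2` and `ord_x I ≤ b` (the prime of `η` in `𝒪_{X,x}` contains the prime element
  `v` and is not maximal, hence equals `(v)` as `dim 𝒪_{X,x}/(v) ≤ 1`; then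
  `I_x 𝒪_{X,η} ⊆ (v)^b 𝒪_{X,η}` gives `v^b ∣ f` for `f ∈ I_x`, and `ord_x I ≤ b` gives equality);
* `Kollar2007.exists_isResolutionOf_nhd_of_stalkIdeal_eq_pow` — **one blow-up resolves** if
  `I_x = H_x^b` for a regular hypersurface ideal `H`: on a neighbourhood where `I = H^b`
  (`exists_nhd_forall_stalkIdeal_eq`) the blowing up of `V(H)` is admissible and its controlled
  transform is the unit ideal (Kollár 3.111 Step 1, codimension-one components of the cosupport);
* **`Kollar2007.exists_isResolutionOf_nhd_of_closedPoint`** — LOCAL ORDER REDUCTION AT EVERY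
  CLOSED POINT OF A SURFACE IN THE TAME REGIME: `X` smooth over a perfect field `k` of
  characteristic `p` (`p = 0` allowed), `max-ord I ≤ b`, `1 ≤ b`, `p = 0 ∨ b < p`, `x` closed with
  `dim 𝒪_{X,x} = 2` ⟹ some open `U ∋ x` carries a blow-up sequence resolving `(U, I|_U, ∅, b)`
  (BGMW Def. 3.1.3). The honest threshold for surfaces is the order `b` (`p > b`).

## Sources

* J. Kollár, *Lectures on Resolution of Singularities* (2007): Thm. 3.69, 3.70, 3.104 Step 2.2,
  3.111 Step 1, Thm. 3.80. [Kollar2007]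
* E. Bierstone, D. Grigoriev, P. Milman, J. Włodarczyk, arXiv:1206.3090: Def. 3.1.3, §3.1
  Remark (3), Thm. 8.0.4, Thm. 8.0.5 (2). [BierstoneGrigorievMilmanWlodarczyk2011]
* The Stacks Project, Tag 01J7 (points of `Spec 𝒪_{X,x}` = generizations of `x`). [StacksProject]
-/

noncomputable section

open CategoryTheory CategoryTheory.Limits AlgebraicGeometry TopologicalSpace IsLocalRing
  Scheme.IdealSheafData

namespace Literature.AlgebraicGeometry.Resolution

universe u

namespace Kollar2007

variable (k : Type u) [Field k] (X : Scheme.{u}) [X.Over (Spec (.of k))]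

/-! ## Bookkeeping: local resolutions on an open are local resolutions -/

/-- A blow-up sequence resolving `(U, I|_U, ∅, b)` on an open `U ∋ x` of an open `V ⊆ X` yields
one on the open `V.ι(U) ∋ x` of `X` (transport along `U ≅ V.ι(U)`, BGMW Thm. 8.0.5 (2) for the
open immersion). [cite: BierstoneGrigorievMilmanWlodarczyk2011, Thm. 8.0.5 (2)] -/
theorem exists_isResolutionOf_nhd_of_opens [IsLocallyNoetherian X] (I : X.IdealSheafData) (b : ℕ)
    (V : X.Opens) (xV : (V : Scheme.{u}))
    (h : ∃ (U : (V : Scheme.{u}).Opens) (_ : xV ∈ U) (s : CentreSeq (U : Scheme.{u})),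
      s.IsResolutionOf ⟨(I.comap V.ι).comap U.ι, [], b⟩) :
    ∃ (U : X.Opens) (_ : V.ι xV ∈ U) (s : CentreSeq (U : Scheme.{u})),
      s.IsResolutionOf ⟨I.comap U.ι, [], b⟩ := by
  obtain ⟨U', hxU', s', hs'⟩ := h
  refine ⟨V.ι ''ᵁ U', ⟨xV, hxU', rfl⟩, s'.restrict (V.ι.isoImage U').inv, ?_⟩
  have h := hs'.restrict (V.ι.isoImage U').inv
  have hI : (I.comap V.ι |>.comap U'.ι).comap (V.ι.isoImage U').inv = I.comap (V.ι ''ᵁ U').ι := by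
    rw [← Scheme.IdealSheafData.comap_comp, ← Scheme.IdealSheafData.comap_comp, Category.assoc,
      Scheme.Hom.isoImage_inv_ι]
  simpa [hI] using h

/-! ## A curve of the cosupport through `x`: `I_x = H_x^b` -/

/-- **If a proper generization `η ⤳ x` lies in `cosupp(I, b) ∩ V(H)` then `I_x = (v^b) = H_x^b`.**
Here `X` is locally Noetherian with `𝒪_{X,x}` regular of dimension `≤ 2`, `H_x = (v)` with
`v ∉ 𝔪_x²`, `ord_η I ≥ b` and `ord_x I ≤ b`. The prime `𝔭_η ⊂ 𝒪_{X,x}` of `η` (Stacks 01J7)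
contains the prime element `v` (`η ∈ V(H)`) and is not `𝔪_x` (`η ≠ x`); as `𝒪_{X,x}/(v)` is a
regular local ring of dimension `≤ 1`, `𝔭_η = (v)`. Then `𝒪_{X,η} = (𝒪_{X,x})_{(v)}` and
`I_x 𝒪_{X,η} ⊆ 𝔪_η^b = (v^b) 𝒪_{X,η}` give `v^b ∣ f` for every `f ∈ I_x`; an element of `I_x` of
order exactly `b` is `v^b` times a unit. [cite: Kollar2007, 3.111 Step 1 (p. 176)]
[cite: StacksProject, Tag 01J7] -/
theorem stalkIdeal_eq_span_pow_of_specializes [IsLocallyNoetherian X] (I H : X.IdealSheafData)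
    {b : ℕ} {x η : X} [IsRegularLocalRing (X.presheaf.stalk x)]
    (hdim : ringKrullDim (X.presheaf.stalk x) ≤ 2) (hη : η ⤳ x) (hne : η ≠ x)
    (hηH : η ∈ H.support) (hηI : (b : ℕ∞) ≤ idealOrder I η) (hxI : idealOrder I x ≤ b)
    {v : X.presheaf.stalk x} (hv : stalkIdeal H x = Ideal.span {v})
    (hv2 : v ∉ (maximalIdeal (X.presheaf.stalk x)) ^ 2) :
    stalkIdeal I x = Ideal.span {v ^ b} := by
  haveI : IsDomain (X.presheaf.stalk x) := isDomain_of_isRegularLocalRing _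
  -- `v ∈ 𝔪_x` (as `x ∈ V(H)`, being a specialization of `η ∈ V(H)`)
  have hxH : x ∈ H.support := H.support.isClosed.closure_subset_iff.mpr
    (Set.singleton_subset_iff.mpr hηH) (hη.mem_closure)
  have hvm : v ∈ maximalIdeal (X.presheaf.stalk x) :=
    (mem_support_iff_stalkIdeal_le H x).mp hxH (hv ▸ Ideal.mem_span_singleton_self v)
  have hvprime : Prime v := IsRegularLocalRing.prime_of_not_mem_sq hvm hv2
  -- the prime of `η`
  letI := (X.presheaf.stalkSpecializes hη).hom.toAlgebra
  set P : Ideal (X.presheaf.stalk x) :=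
    (maximalIdeal (X.presheaf.stalk η)).comap (X.presheaf.stalkSpecializes hη).hom with hPdef
  haveI hloc : IsLocalization.AtPrime (X.presheaf.stalk η) P := isLocalizationAtPrime_stalkSpecializes hη
  have halg : algebraMap (X.presheaf.stalk x) (X.presheaf.stalk η) =
      (X.presheaf.stalkSpecializes hη).hom := rfl
  -- (a) `v ∈ P`
  have hvP : v ∈ P := by
    have h1 : stalkIdeal H η ≤ maximalIdeal _ := (mem_support_iff_stalkIdeal_le H η).mp hηH
    rw [← stalkIdeal_map_stalkSpecializes H hη, hv, Ideal.map_le_iff_le_comap,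
      Ideal.span_singleton_le_iff_mem] at h1
    exact h1
  -- (b) `P ≠ 𝔪_x`
  have hPm : P ≠ maximalIdeal (X.presheaf.stalk x) := by
    intro hPm
    apply hne
    obtain ⟨q, hq⟩ : η ∈ Set.range (X.fromSpecStalk x) := by
      rw [Scheme.range_fromSpecStalk]; exact hη
    have hq' : primeOfSpecializes (fromSpecStalk_specializes q) = q.asIdeal :=
      primeOfSpecializes_fromSpecStalk q
    have hPq : P = q.asIdeal := by
      rw [← hq']
      subst hq
      rfl
    have hqc : q = closedPoint (X.presheaf.stalk x) := by
      apply PrimeSpectrum.ext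
      rw [← hPq, hPm]
      rfl
    rw [← hq, hqc, Scheme.fromSpecStalk_closedPoint]
  -- (c) `P = (v)`: the image of `P` in the regular local ring `R/(v)` of dimension `≤ 1`
  have hPv : P = Ideal.span {v} := by
    obtain ⟨hSreg, hSdim⟩ := IsRegularLocalRing.quotient_span_singleton hvm hv2
    haveI := hSreg
    haveI : IsDomain (X.presheaf.stalk x ⧸ Ideal.span {v}) := isDomain_of_isRegularLocalRing _
    have hS1 : ringKrullDim (X.presheaf.stalk x ⧸ Ideal.span {v}) ≤ 1 := by
      obtain ⟨n, hn⟩ := exists_nat_cast_eq_ringKrullDim (R := X.presheaf.stalk x ⧸ Ideal.span {v})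
      obtain ⟨m, hm⟩ := exists_nat_cast_eq_ringKrullDim (R := X.presheaf.stalk x)
      rw [hn, hm] at hSdim
      rw [hm] at hdim
      rw [hn]
      have h1 : n + 1 = m := by
        have : ((n + 1 : ℕ) : WithBot ℕ∞) = ((m : ℕ) : WithBot ℕ∞) := by push_cast; exact hSdim
        exact_mod_cast this
      have h2 : m ≤ 2 := by exact_mod_cast hdim
      exact_mod_cast (show n ≤ 1 by omega)
    haveI : Ring.KrullDimLE 1 (X.presheaf.stalk x ⧸ Ideal.span {v}) := (Ring.krullDimLE_iff).mpr hS1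
    have hker : RingHom.ker (Ideal.Quotient.mk (Ideal.span {v})) ≤ P := by
      rw [Ideal.mk_ker]; exact (Ideal.span_singleton_le_iff_mem _).mpr hvP
    set Q : Ideal (X.presheaf.stalk x ⧸ Ideal.span {v}) := P.map (Ideal.Quotient.mk (Ideal.span {v})) with hQ
    haveI hQp : Q.IsPrime := Ideal.map_isPrime_of_surjective Ideal.Quotient.mk_surjective hker
    have hcomapQ : Q.comap (Ideal.Quotient.mk (Ideal.span {v})) = P := by
      rw [hQ, Ideal.comap_map_of_surjective _ Ideal.Quotient.mk_surjective,
        sup_eq_left.mpr (by rwa [← RingHom.ker_eq_comap_bot])]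
    by_cases hQ0 : Q = ⊥
    · refine le_antisymm ?_ ((Ideal.span_singleton_le_iff_mem _).mpr hvP)
      rw [← hcomapQ, hQ0, ← RingHom.ker_eq_comap_bot, Ideal.mk_ker]
    · exfalso
      have hQmax : Q.IsMaximal :=
        (Ring.krullDimLE_one_iff_of_noZeroDivisors.mp inferInstance) Q hQ0 hQp
      apply hPm
      rw [← hcomapQ, IsLocalRing.eq_maximalIdeal hQmax]
      haveI : IsLocalHom (Ideal.Quotient.mk (Ideal.span {v})) :=
        IsLocalHom.of_surjective _ Ideal.Quotient.mk_surjective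
      exact maximalIdeal_comap (Ideal.Quotient.mk (Ideal.span {v}))
  -- (d) `I_x ⊆ (v^b)`
  have hle : stalkIdeal I x ≤ Ideal.span {v ^ b} := by
    intro f hf
    have h1 : stalkIdeal I η ≤ maximalIdeal _ ^ b := (le_idealOrder_iff I η b).mp hηI
    rw [← stalkIdeal_map_stalkSpecializes I hη, ← halg,
      ← IsLocalization.AtPrime.map_eq_maximalIdeal P (X.presheaf.stalk η), ← Ideal.map_pow, hPv,
      Ideal.span_singleton_pow] at h1
    have h2 : algebraMap (X.presheaf.stalk x) (X.presheaf.stalk η) f ∈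
        (Ideal.span {v ^ b}).map (algebraMap (X.presheaf.stalk x) _) :=
      h1 (Ideal.mem_map_of_mem _ hf)
    rw [IsLocalization.mem_map_algebraMap_iff P.primeCompl] at h2
    obtain ⟨⟨⟨i, hi⟩, ⟨s, hs⟩⟩, h3⟩ := h2
    simp only at h3
    have hinj : Function.Injective (algebraMap (X.presheaf.stalk x) (X.presheaf.stalk η)) :=
      IsLocalization.injective _ P.primeCompl_le_nonZeroDivisors
    rw [← map_mul] at h3
    have h4 : f * s = i := hinj h3
    obtain ⟨c, hc⟩ := Ideal.mem_span_singleton.mp hi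
    have hvs : ¬ v ∣ s := fun hd => hs (hPv ▸ Ideal.mem_span_singleton.mpr hd)
    have h5 : v ^ b ∣ f * s := ⟨c, h4.trans hc⟩
    exact Ideal.mem_span_singleton.mpr (hvprime.pow_dvd_of_dvd_mul_right b hvs h5)
  -- (e) equality from `ord_x I ≤ b`
  refine le_antisymm hle ?_
  have hnot : ¬ stalkIdeal I x ≤ maximalIdeal (X.presheaf.stalk x) ^ (b + 1) := by
    intro h
    have := (le_idealOrder_iff I x (b + 1)).mpr h
    have h' := this.trans hxI
    exact absurd (ENat.coe_le_coe.mp h') (by omega)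
  obtain ⟨f, hfI, hfb⟩ := SetLike.not_le_iff_exists.mp hnot
  obtain ⟨g, rfl⟩ := Ideal.mem_span_singleton.mp (hle hfI)
  have hg : IsUnit g := by
    by_contra hg
    apply hfb
    rw [pow_succ]
    exact Ideal.mul_mem_mul (Ideal.pow_mem_pow hvm b) ((mem_maximalIdeal _).mpr hg)
  rw [Ideal.span_singleton_le_iff_mem]
  have : v ^ b = v ^ b * g * ↑hg.unit⁻¹ := by rw [mul_assoc, IsUnit.mul_val_inv, mul_one]
  rw [this]
  exact Ideal.mul_mem_right _ _ hfI

/-! ## One blow-up resolves `I = H^b` near `x` (Kollár 3.111 Step 1) -/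

/-- **If `I_x = H_x^b` for a regular hypersurface ideal `H ∋ x`, one blowing up resolves `(I, b)`
near `x`**: on an open `U ∋ x` with `I|_U = (H|_U)^b` (stalk equality spreads to a neighbourhood,
`exists_nhd_forall_stalkIdeal_eq`) the centre `V(H|_U)` is regular, has simple normal crossings
with the empty boundary and lies in `cosupp(I|_U, b)`, and the controlled transform
`(π^*(H^b) : (π^*H)^b)` is the unit ideal — Kollár's 3.111 Step 1 for a codimension-one component
of the cosupport (`X` regular, locally Noetherian, `b ≥ 1`). [cite: Kollar2007, 3.111 Step 1 (p. 176)]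
[cite: BierstoneGrigorievMilmanWlodarczyk2011, Def. 3.1.3] -/
theorem exists_isResolutionOf_nhd_of_stalkIdeal_eq_pow [IsLocallyNoetherian X]
    (hXreg : Scheme.IsRegular X) (I : X.IdealSheafData) {b : ℕ} (hb : 1 ≤ b) {H : X.IdealSheafData}
    (hH : ∀ x ∈ H.support, ∃ v : X.presheaf.stalk x,
      stalkIdeal H x = Ideal.span {v} ∧ v ∉ (maximalIdeal (X.presheaf.stalk x)) ^ 2)
    {x : X} (hIx : stalkIdeal I x = stalkIdeal (H ^ b) x) :
    ∃ (U : X.Opens) (_ : x ∈ U) (s : CentreSeq (U : Scheme.{u})),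
      s.IsResolutionOf ⟨I.comap U.ι, [], b⟩ := by
  classical
  obtain ⟨U, hxU, hU⟩ := exists_nhd_forall_stalkIdeal_eq (X := X) hIx
  have hUreg : Scheme.IsRegular (U : Scheme.{u}) := fun y => by
    haveI : IsIso (U.ι.stalkMap y) := (IsOpenImmersion.iff_isIso_stalkMap.mp inferInstance).2 y
    haveI := hXreg (U.ι y)
    exact IsRegularLocalRing.of_ringEquiv (asIso (U.ι.stalkMap y)).commRingCatIsoToRingEquiv
  set H' : (U : Scheme.{u}).IdealSheafData := H.comap U.ι with hH'def
  have hH' : ∀ y ∈ H'.support, ∃ v : (U : Scheme.{u}).presheaf.stalk y,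
      stalkIdeal H' y = Ideal.span {v} ∧ v ∉ (maximalIdeal ((U : Scheme.{u}).presheaf.stalk y)) ^ 2 :=
    fun y hy => exists_generator_notMem_sq_comap_of_isLocalIso U.ι hH y hy
  -- `I|_U = (H|_U)^b`
  have hIU : I.comap U.ι = H' ^ b := by
    rw [hH'def, ← comap_pow]
    refine le_antisymm (le_of_forall_stalkIdeal_le fun y => ?_)
      (le_of_forall_stalkIdeal_le fun y => ?_) <;>
    haveI : IsIso (U.ι.stalkMap y) := (IsOpenImmersion.iff_isIso_stalkMap.mp inferInstance).2 y
    · exact ((stalkIdeal_comap_eq_iff_of_isIso_stalkMap U.ι I (H ^ b) y).mpr (hU _ y.2)).le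
    · exact ((stalkIdeal_comap_eq_iff_of_isIso_stalkMap U.ι I (H ^ b) y).mpr (hU _ y.2)).ge
  refine ⟨U, hxU, CentreSeq.cons H' (CentreSeq.nil _), ?_, ?_⟩
  · refine (CentreSeq.isAdmissibleFor_cons H' _ _).mpr ⟨?_, ?_, isRegular_subscheme_of_generator _ hUreg hH', trivial⟩
    · -- `V(H') ⊆ cosupp(I|_U, b)`: `I_y = H'_y^b ⊆ 𝔪_y^b`
      intro y hy
      rw [MarkedIdeal.mem_support_iff]
      change stalkIdeal (I.comap U.ι) y ≤ _
      rw [hIU, stalkIdeal_pow]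
      exact Ideal.pow_right_mono ((mem_support_iff_stalkIdeal_le H' y).mp hy) b
    · -- simple normal crossings with the empty boundary
      have h1 := (hasSNC_singleton_of_generator hUreg hH').hasSNCWith_finsetSup {H'} (by simp)
      rw [Finset.sup_singleton, id] at h1
      exact h1.of_cons
  · -- the controlled transform is the unit ideal
    show (((⟨I.comap U.ι, [], b⟩ : MarkedIdeal (U : Scheme.{u})).transform (blowup.π H') H').support
      : Set (blowup H')) = ∅
    have htop : controlledTransform (blowup.π H') H' (I.comap U.ι) b = ⊤ := by
      rw [controlledTransform, hIU, comap_pow]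
      exact top_le_iff.mp (le_colon_iff.mpr (by rw [Scheme.IdealSheafData.mul_top]))
    refine Set.eq_empty_iff_forall_notMem.mpr fun y hy => ?_
    rw [MarkedIdeal.mem_support_iff, MarkedIdeal.transform_ideal, MarkedIdeal.transform_mult, htop,
      stalkIdeal_top, top_le_iff, Ideal.eq_top_iff_one] at hy
    have h1 : (1 : (blowup H').presheaf.stalk y) ∈ maximalIdeal _ :=
      Ideal.pow_le_self (by change b ≠ 0; omega) hy
    exact (maximalIdeal.isMaximal _).ne_top (Ideal.eq_top_of_isUnit_mem _ h1 isUnit_one)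

/-! ## The local theorem at every closed point of a surface -/

/-- **Topological dichotomy at a closed point of a closed set in a Noetherian sober space**:
either `x` is isolated in `F`, or some `ξ ≠ x` of `F` specialises to `x`.
[cite: StacksProject, Tag 0052] -/
theorem exists_nhd_inter_subset_singleton_or_exists_specializes {α : Type*} [TopologicalSpace α]
    [NoetherianSpace α] [QuasiSober α] {F : Set α} (hF : IsClosed F) {x : α}
    (hx : IsClosed ({x} : Set α)) :
    (∃ V : Set α, IsOpen V ∧ x ∈ V ∧ F ∩ V ⊆ {x}) ∨ ∃ ξ ∈ F, ξ ⤳ x ∧ ξ ≠ x := by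
  by_cases hcl : x ∈ closure (F \ {x})
  · right
    obtain ⟨ξ, hξx, hξ⟩ := exists_specializes_mem_closure_inter (F \ {x}) hcl
    have hξne : ξ ≠ x := by
      rintro rfl
      rw [hx.closure_eq, Set.sdiff_inter_self, closure_empty] at hξ
      exact hξ
    refine ⟨ξ, ?_, hξx, hξne⟩
    have h1 : closure ((F \ {x}) ∩ closure {ξ}) ⊆ F :=
      (closure_mono Set.inter_subset_left).trans
        ((closure_mono Set.sdiff_subset).trans hF.closure_subset)
    exact h1 hξ
  · left
    refine ⟨(closure (F \ {x}))ᶜ, isClosed_closure.isOpen_compl, hcl, fun y hy => ?_⟩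
    by_contra hyx
    exact hy.2 (subset_closure ⟨hy.1, hyx⟩)

/-- The local theorem on a Noetherian `X` (the general case restricts to an affine open first).
[cite: Kollar2007, Thm. 3.69, 3.104 Step 2.2, 3.111 Step 1] -/
theorem exists_isResolutionOf_nhd_of_closedPoint_of_noetherianSpace (p : ℕ) [CharP k p]
    [PerfectField k] [Smooth (X ↘ Spec (.of k))] [NoetherianSpace X] (I : X.IdealSheafData)
    {b : ℕ} (hb : 1 ≤ b) (hbp : p = 0 ∨ b < p) (hmax : ∀ x : X, idealOrder I x ≤ b) (x : X)
    (hxcl : IsClosed ({x} : Set X)) (hdim : ringKrullDim (X.presheaf.stalk x) = 2) :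
    ∃ (U : X.Opens) (_ : x ∈ U) (s : CentreSeq (U : Scheme.{u})),
      s.IsResolutionOf ⟨I.comap U.ι, [], b⟩ := by
  classical
  haveI : IsLocallyNoetherian X := isLocallyNoetherian_of_locallyOfFiniteType_over k X
  have hF : IsClosed (⟨I, [], b⟩ : MarkedIdeal X).support :=
    MarkedIdeal.isClosed_support (hasFinitePresentationDifferentials_overHom k X)
      (hasLocalCoordinates_overHom k X) _
      (fun y j hj hjb => isUnit_natCast_stalk_of_char k X p (hbp.imp id le_of_lt) y j hj hjb)
  rcases exists_nhd_inter_subset_singleton_or_exists_specializes hF hxcl with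
    ⟨V, hV, hxV, hFV⟩ | ⟨ξ, hξF, hξx, hξne⟩
  · -- `x` is isolated in (or off) the cosupport
    exact exists_isResolutionOf_nhd_of_isolated k X p I hb hbp hmax x hxcl hdim ⟨V, hV⟩ hxV hFV
  · -- a curve of the cosupport passes through `x`: `I = H^b` near `x`
    obtain ⟨U, hxU, H, hHmc, hH, hsub, -⟩ := exists_isMaxContact_nhd_of_char k X p I hb hbp hmax x
    haveI : Smooth ((U : Scheme.{u}) ↘ Spec (.of k)) :=
      inferInstanceAs (Smooth (U.ι ≫ X ↘ Spec (.of k)))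
    haveI : IsLocallyNoetherian (U : Scheme.{u}) := isLocallyNoetherian_of_locallyOfFiniteType_over k _
    have hUreg : Scheme.IsRegular (U : Scheme.{u}) := Scheme.isRegular_of_smooth_over_field k _
    have hξU : ξ ∈ U := hξx.mem_open U.2 hxU
    let xU : (U : Scheme.{u}) := ⟨x, hxU⟩
    let ξU : (U : Scheme.{u}) := ⟨ξ, hξU⟩
    have hsuppU : ((⟨I.comap U.ι, [], b⟩ : MarkedIdeal (U : Scheme.{u})).support) =
        U.ι ⁻¹' (⟨I, [], b⟩ : MarkedIdeal X).support :=
      MarkedIdeal.support_comap_of_isOpenImmersion U.ι (⟨I, [], b⟩ : MarkedIdeal X)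
    have hξsupp : ξU ∈ (⟨I.comap U.ι, [], b⟩ : MarkedIdeal (U : Scheme.{u})).support := by
      rw [hsuppU]; exact hξF
    have hxF : x ∈ (⟨I, [], b⟩ : MarkedIdeal X).support :=
      hF.closure_subset_iff.mpr (Set.singleton_subset_iff.mpr hξF) hξx.mem_closure
    have hxsupp : xU ∈ (⟨I.comap U.ι, [], b⟩ : MarkedIdeal (U : Scheme.{u})).support := by
      rw [hsuppU]; exact hxF
    haveI := hUreg xU
    obtain ⟨v, hv, hv2⟩ := hH xU (hsub hxsupp)
    have hIx : stalkIdeal (I.comap U.ι) xU = Ideal.span {v ^ b} :=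
      stalkIdeal_eq_span_pow_of_specializes (U : Scheme.{u}) (I.comap U.ι) H
        (by rw [ringKrullDim_stalk_opens]; exact hdim.le)
        ((U.ι.isOpenEmbedding.isInducing.specializes_iff (x := ξU) (y := xU)).mp hξx)
        (fun h => hξne (congrArg Subtype.val h)) (hsub hξsupp) hξsupp
        (by rw [idealOrder_comap_of_isOpenImmersion]; exact hmax x) hv hv2
    have hIx' : stalkIdeal (I.comap U.ι) xU = stalkIdeal (H ^ b) xU := by
      rw [hIx, stalkIdeal_pow, hv, Ideal.span_singleton_pow]
    exact exists_isResolutionOf_nhd_of_opens X I b U xU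
      (exists_isResolutionOf_nhd_of_stalkIdeal_eq_pow (U : Scheme.{u}) hUreg (I.comap U.ι) hb hH hIx')

/-- **Local order reduction at every closed point of a surface, tame regime.** Let `X` be
smooth over a perfect field `k` of characteristic `p` (`p = 0` allowed), `I` an ideal sheaf with
`max-ord I ≤ b`, `1 ≤ b` and `p = 0 ∨ b < p`, and `x` a closed point with `dim 𝒪_{X,x} = 2`. Then
some open `U ∋ x` carries a blow-up sequence RESOLVING the marked ideal `(U, I|_U, ∅, b)` in the
sense of BGMW Def. 3.1.3 (`CentreSeq.IsResolutionOf`: regular centres inside the successive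
cosupports, simple normal crossings with the exceptional boundary, final cosupport empty).
Either `x` is isolated in `cosupp(I, b)` — maximal-contact curve (Kollár Thm. 3.80, `ord < p`),
characteristic-free order reduction of the restricted coefficient ideal on that curve, going up
(Cor. 3.85), `KollarSurfaceOrderReductionTame.lean` — or a curve of the cosupport passes through
`x`, and then `I = H^b` near `x` is resolved by one blowing up (3.111 Step 1). For SURFACES the
characteristic-zero algorithm therefore terminates locally as soon as `p > b = max-ord I`: the
factorial threshold of the second level (`KollarNextLevelTame.lean`) never intervenes, the second
level being a curve. [cite: Kollar2007, Thm. 3.69, 3.70, 3.104 Step 2.2, 3.111 Step 1, Thm. 3.80]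
[cite: BierstoneGrigorievMilmanWlodarczyk2011, Def. 3.1.3, Thm. 8.0.4] -/
theorem exists_isResolutionOf_nhd_of_closedPoint (p : ℕ) [CharP k p] [PerfectField k]
    [Smooth (X ↘ Spec (.of k))] (I : X.IdealSheafData) {b : ℕ} (hb : 1 ≤ b) (hbp : p = 0 ∨ b < p)
    (hmax : ∀ x : X, idealOrder I x ≤ b) (x : X) (hxcl : IsClosed ({x} : Set X))
    (hdim : ringKrullDim (X.presheaf.stalk x) = 2) :
    ∃ (U : X.Opens) (_ : x ∈ U) (s : CentreSeq (U : Scheme.{u})),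
      s.IsResolutionOf ⟨I.comap U.ι, [], b⟩ := by
  haveI : IsLocallyNoetherian X := isLocallyNoetherian_of_locallyOfFiniteType_over k X
  -- restrict to an affine (Noetherian) open neighbourhood `W` of `x`
  obtain ⟨W, hW, hxW, -⟩ :=
    exists_isAffineOpen_mem_and_subset (X := X) (x := x) (U := ⊤) (Opens.mem_top x)
  haveI : IsNoetherianRing Γ(X, W) := IsLocallyNoetherian.component_noetherian ⟨W, hW⟩
  haveI : NoetherianSpace (W : Scheme.{u}) := noetherianSpace_of_isAffineOpen W hW
  haveI : Smooth ((W : Scheme.{u}) ↘ Spec (.of k)) :=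
    inferInstanceAs (Smooth (W.ι ≫ X ↘ Spec (.of k)))
  have hinjW : Function.Injective (W : X.Opens).ι := W.ι.isOpenEmbedding.injective
  let xW : (W : Scheme.{u}) := ⟨x, hxW⟩
  have hxWx : W.ι xW = x := rfl
  have hxWcl : IsClosed ({xW} : Set (W : Scheme.{u})) := by
    have : ({xW} : Set (W : Scheme.{u})) = W.ι ⁻¹' {x} := by
      ext y
      simp only [Set.mem_singleton_iff, Set.mem_preimage]
      exact ⟨fun h => by rw [h, hxWx], fun h => hinjW (by rw [h, hxWx])⟩
    rw [this]
    exact hxcl.preimage W.ι.continuous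
  have hdimW : ringKrullDim ((W : Scheme.{u}).presheaf.stalk xW) = 2 := by
    rw [ringKrullDim_stalk_opens, hxWx, hdim]
  have hmaxW : ∀ y : (W : Scheme.{u}), idealOrder (I.comap W.ι) y ≤ b := fun y => by
    rw [idealOrder_comap_of_isOpenImmersion]
    exact hmax _
  exact exists_isResolutionOf_nhd_of_opens X I b W xW
    (exists_isResolutionOf_nhd_of_closedPoint_of_noetherianSpace k (W : Scheme.{u}) p (I.comap W.ι)
      hb hbp hmaxW xW hxWcl hdimW)

end Kollar2007

end Literature.AlgebraicGeometry.Resolution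

end
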